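import Literature.NumberTheory.EllipticCurves.EllCurveTorsionLevelStructure
import Literature.NumberTheory.EllipticCurves.EllCurveTorsionBaseChange
import HarnessLib

/-!
# Level structures in `E[N]` under base change

Topic: `Literature/NumberTheory/EllipticCurves`. Closes the loop between
`EllCurveTorsionLevelStructure.lean` (a level structure `φ` as the homomorphism
`torsHom φ : (ℤ/N)² →* E[N](S)`) and `EllCurveTorsionBaseChange.lean` (`E'[N](X') ≃ E[N](X'|_S)`
for a base change `E' = S' ×_S E`, `IsBaseChangeVia.torsionHomEquiv`): for a base change of LEVEL
STRUCTURES `h : φ'.IsBaseChangeVia φ g G` (`G` carries `P', Q'` to `P ∘ g, Q ∘ g`,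
`KugaSatoVariety.lean`), the identification carries `torsHom φ'` to the restriction of `torsHom φ`
along `S' → S`:

* `LevelStructure.IsBaseChangeVia.torsionHomEquiv_torsHom` —
  `torsionHomEquiv (torsHom φ' u) = (S'|_S → S) ≫ torsHom φ u`;
* `LevelStructure.IsBaseChangeVia.torsionHomEquiv_restrictTorsHom` — the same on geometric
  fibres: for `s' : Spec Ω → S'`, the point `φ'(u)(s')` of `E'[N]` corresponds to the point
  `φ(u)(s' ≫ g)` of `E[N]` (Deligne (3.6): morphisms of pairs `(E, α)`; Katz–Mazur (3.1):
  level structures are functorial in the base).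

All proved; no named facts.

## References

* P. Deligne, *Formes modulaires et représentations ℓ-adiques*, Sém. Bourbaki 355 (1969), (3.6).
  [Deligne1971Bourbaki355]
* N. Katz, B. Mazur, *Arithmetic moduli of elliptic curves* (1985), (3.1). [KatzMazur1985]
-/

universe u

open CategoryTheory Limits AlgebraicGeometry MonoidalCategory CartesianMonoidalCategory
open scoped MonObj

noncomputable section

namespace Literature.NumberTheory.EllipticCurves

namespace EllCurveOver.LevelStructure.IsBaseChangeVia

variable {S S' : Scheme.{u}} {C' : EllCurveOver S'} {C : EllCurveOver S} [IsCommMonObj C'.E]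
  [IsCommMonObj C.E] {N : ℕ} [NeZero N] {φ' : LevelStructure N C'} {φ : LevelStructure N C}
  {g : S' ⟶ S} {G : C'.E.left ⟶ C.E.left} (h : φ'.IsBaseChangeVia φ g G)

include h

/-- **Base change carries `torsHom φ'` to the restriction of `torsHom φ`**: under
`E'[N](S') ≃ E[N](S'|_S)` the section `φ'(u)` of `E'[N]` corresponds to `(S' → S) ≫ φ(u)`
(`push_section_`: `φ'(u) ≫ G = g ≫ φ(u)`). [cite: KatzMazur1985, (3.1)] -/
theorem torsionHomEquiv_torsHom (u : Multiplicative (ZMod N × ZMod N)) :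
    h.curve.torsionHomEquiv (𝟙_ (Over S')) N (φ'.torsHom u) =
      toUnit _ ≫ φ.torsHom u := by
  apply KugaSato.torsion_hom_ext C.E
  rw [EllCurveOver.IsBaseChangeVia.torsionHomEquiv_comp_ι, torsHom_ι, h.push_section_,
    Category.assoc, torsHom_ι]

/-- **The same on geometric fibres**: for `s' : Spec Ω → S'`, the identification
`E'[N](s') ≃ E[N](s'|_S)` carries `φ'(u)(s')` to `φ(u)(s' ≫ g)` — the level structures of `E'`
and `E` agree fibre by fibre (Deligne (3.6): morphisms of pairs `(E, α)`).
[cite: Deligne1971Bourbaki355, (3.6)] -/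
theorem torsionHomEquiv_restrictTorsHom {Ω : Type u} [Field Ω] (s' : Spec (.of Ω) ⟶ S')
    (u : Multiplicative (ZMod N × ZMod N)) :
    h.curve.torsionHomEquiv (Over.mk s') N (φ'.restrictTorsHom s' u) =
      toUnit _ ≫ φ.torsHom u := by
  apply KugaSato.torsion_hom_ext C.E
  rw [EllCurveOver.IsBaseChangeVia.torsionHomEquiv_comp_ι, restrictTorsHom_apply, Category.assoc,
    torsHom_ι, Category.assoc, torsHom_ι]
  -- `push (toUnit ≫ φ'(u)) = toUnit ≫ push (φ'(u))`: `push` is post-composition with `G` on `.left`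
  ext
  rw [EllCurveOver.IsBaseChangeVia.push_left, Over.comp_left, Over.comp_left, Category.assoc,
    ← h.curve.push_left, h.push_section_, Over.comp_left]
  rfl

/-- The restricted level structure of `E` at the point `s' ≫ g` of `S`, read in `E[N]`, is the
image of that of `E'` at `s'`: `torsionHomEquiv (φ'.restrictTorsHom s' u) ≫ ι_E =
(φ(u))(s' ≫ g)` as a morphism of schemes `Spec Ω → E`. [folklore] -/
theorem torsionHomEquiv_restrictTorsHom_ι_left {Ω : Type u} [Field Ω] (s' : Spec (.of Ω) ⟶ S')
    (u : Multiplicative (ZMod N × ZMod N)) :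
    (h.curve.torsionHomEquiv (Over.mk s') N (φ'.restrictTorsHom s' u) ≫
        KugaSato.torsionι C.E N).left =
      (C.restrict (s' ≫ g) (φ.section_ u.toAdd)).left := by
  rw [h.torsionHomEquiv_restrictTorsHom, Category.assoc, torsHom_ι, Over.comp_left,
    Over.comp_left]
  rfl

end EllCurveOver.LevelStructure.IsBaseChangeVia

end Literature.NumberTheory.EllipticCurves

end
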